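import Summits.AnomalousDissipation.AnomalousDissipation.Theses.StirringSphere
import Summits.AnomalousDissipation.AnomalousDissipation.Theses.Ensemble
import Summits.AnomalousDissipation.AnomalousDissipation.Theorems.StirringSphereEnsembleRealizationDiss
import Summits.AnomalousDissipation.AnomalousDissipation.Theorems.StirringSphereEnsembleRealizationStubCylEnergyIneqFluxLimit
import HarnessLib.Audit

/-!
# Crux `EnsembleRealization` (stmt-AnomalousDissipation-0215; routes StirringSphere rank 5,
# Ensemble rank 3) — line `augmented-lift`: skeleton and kernel-checked composition

THE CRUX. For a smooth solenoidal mean-zero force `f` and budgets `E`, `ε > 0` there is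
`M = M(f, E, ε)` such that at every viscosity `ν > 0`, every Foias–Prodi stationary statistical
solution `μ` of NS_ν(f) with mean energy `≤ E` and mean dissipation `≥ ε` is SHADOWED by one global
Leray–Hopf trajectory with `meanEnergy ≤ M` and `meanDissipation ≥ ε/2`.

THE LINE (energy-augmented superposition). The registered line `superposition-lift` isolates the
open content of the crux as the Leray–Hopf ADMISSIBILITY of a stationary distributional lift of
`μ` (its `stub_admissibleLift`, an existence statement over path measures). This line FACTORS that
existence statement through a STATIC, LINEAR condition on the measure `μ` itself:

* `CEI(ν, f, μ)` (written inline in stubs A and B) — the **cylindrically weighted energy inequalities**: for every finite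
  family of smooth solenoidal mean-zero test fields `g₁ … g_m` (cylindrical coordinates
  `ξ(u) = ((u,g₁),…,(u,g_m))`) and every bounded `C¹` profile `ψ(ξ, e)` with bounded derivative,
  NONDECREASING in the energy variable `e`,
  `2 ∫ ∂ₑψ(ξ(u), |u|²) (ν‖u‖_V² − (f,u)) dμ ≤ ∫ ⟨F(u), Σⱼ ∂ⱼψ(ξ(u), |u|²) gⱼ⟩ dμ`.
  For `ψ = ψ(e)` this is exactly the Foias–Prodi shell inequality (1.31) (tree:
  `IsStationaryStatisticalSolution.energy_ineq`; FoiasRosaTemam2019 Def. 4.1 (c)); for `ψ = ψ(ξ)` it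
  is the Liouville identity (1.30) (`….generator`). The mixed family says, through the Galerkin
  approximation `|P_K u|² → |u|²` inside `ψ` (the tree's own device `galerkinTest`,
  `integral_galerkinBalance_eq_zero`), that the `K → ∞` limit of the energy FLUX through
  wavenumber `K`, `−inertialPairing u (P_K u) = b(u,u,P_K u)`, weighted by any nonnegative bounded
  observable of (large scales, energy), is nonnegative: NO MEAN BACKSCATTER FROM INFINITE
  WAVENUMBER, conditionally on cylindrical data. Every time-average / Vishik–Fursikov / Galerkin
  Krylov–Bogoliubov measure satisfies it (chain rule for `ψ(ξ(u(t)), e(t))` along a Leray–Hopf path,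
  `e(t) + ∫₀ᵗ(ν‖u‖_V² − (f,u))` nonincreasing, Vol'pert). Whether EVERY Foias–Prodi measure does is
  `stub_cylEnergyIneq` — OPEN, the typed residue of this line (strictly between FP and VF).
* `stub_augmentedLift` — the MECHANISM (new): `CEI` ⇒ an admissible shift-invariant lift.
  Adjoin the energy as an extra coordinate: the joint law `μ̃_N` of `(P_N u, |u|²)` on
  `ℝ^{d_N} × ℝ` satisfies, by `CEI` and the Riesz representation of the positive defect
  functional `∂ₑψ ↦ ∫(∇_ξψ·b_N − ∂ₑψ d_N) dμ̃_N` (well defined modulo Liouville), the stationary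
  continuity equation `div_w(b_N μ̃_N) + ∂ₑ(−d_N μ̃_N − σ_N) = 0` with the conditional drift
  `b_N = E[P_N F(u) | P_N u, |u|²]` (exactly the projected field of Ambrosio–Trevisan's proof of
  their Thm 7.1), the conditional dissipation `d_N = E[ν‖u‖_V² − (f,u) | P_N u, |u|²] ≥
  ν‖P_N u‖_V² − (f, P_N u) − o(1)` and a NONNEGATIVE finite defect measure `σ_N` of total mass
  `∫(f,u)dμ − ν∫‖u‖_V²dμ ≥ 0` (the ensemble anomalous dissipation of `μ`). After mollification
  (which makes `σ_N ≪ μ̃_N` and keeps the sign) the finite-dimensional superposition principle for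
  `L¹` fields (Ambrosio 2004 / Ambrosio–Crippa, `r = 1`) and Krylov–Bogoliubov give a stationary law
  on pairs (coefficient path `w`, energy path `e`) with `ė ≤ −(ν‖w‖_V² − (f,w)) + o(1)` PATHWISE and
  one-time marginals `μ̃_N * ρ_δ`. Letting `N → ∞`, `δ → 0` in MomentParity's compact trajectory space
  `𝒦 = pathSpace R (pathLip ν ‖f‖₁ R)` × (Helly-compact monotone-plus-Lipschitz energy paths): the
  `w`-paths become modewise Navier–Stokes solutions (the mode-`k` stress error is
  `≤ C_k (E‖Q_N u‖²)^{1/2} (E‖u‖_V²)^{1/2} → 0`, strong `L²_{t,x}` convergence on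
  `{∫‖w‖_V² ≤ C}` by Aubin–Lions–Simon), the energy paths satisfy
  `e(t) − e(s) ≤ −∫ₛᵗ (ν‖v‖_V² − (f,v))` for all `t ≥ s` off a countable set (Fatou + weak lower
  semicontinuity of `‖·‖_V`), and the marginal identity `law(v̂(t), e(t)) = law(û, |u|²)` forces
  `e(t) = |v(t)|²` a.s. for a.e. `t` (the joint law sits on a graph): the Leray–Hopf inequality from
  a.e. time for a.e. path, i.e. the conclusion of `superposition-lift`'s `stub_admissibleLift`,
  WITHOUT assuming any lift.
Downstream the composition is that of `superposition-lift` verbatim: `stub_marginalMeans` and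
`stub_pathwiseCoupling` (re-declared here with byte-identical names and signatures, so ONE proof
serves both lines), the a.e. Birkhoff–Chebyshev selection `exists_good_point_ae` and
`chebyshev_gap'` (proved, copied), and the LANDED `MomentParity.stub_timeAverages` (by name).

STATUS (lead, 2026-08-17 17:30Z): every stub of this line EXCEPT `stub_cylEnergyIneq` (OPEN — FP ⇒ CEI) has been
proved and LANDED under `Theorems/StirringSphereEnsembleRealization*.lean` (namespace
`…Theorems.EnsembleRealization`): stub B was reshaped into `stub_augCurrentLevelPairs` + `stub_augCurrentPathLawTools`
(level laws of the smooth stationary currents built from `CEI`) → `stub_augLimit` → `stub_augWeakForm` → `stub_augEnergy`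
→ `stub_restart`, composed below by tree name; stubs C, D = `stub_marginalMeans`, `stub_pathwiseCoupling`; tools for
stub A = `stub_cylEnergyIneqGalerkinIdentity`, `stub_cylEnergyIneqFluxLimit` (CEI ⇔ no mean backscatter). The landed
`…Diss.lean` records the two consequences: the crux holds on the dissipative class FP + CEI
(`stub_ensembleRealizationDiss`) and `(∀ FP ⇒ CEI) → EnsembleRealization` (`ensembleRealization_of_cei`).
Composition: `ensembleRealization_of` (StirringSphere decl) and `ensemble_ensembleRealization_of` (the byte-identical
Ensemble decl); 1 sorry = `stub_cylEnergyIneq`.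
-/

noncomputable section

-- every `Summit.AnomalousDissipation.AnomalousDissipation.…` name repeats the summit = sub-problem segment (D-0017 layout)
set_option linter.dupNamespace false

open MeasureTheory Set Filter Topology Function Metric UnitAddTorus
open scoped BigOperators ENNReal InnerProductSpace RealInnerProductSpace

namespace Summit.AnomalousDissipation.AnomalousDissipation.Cruxes.EnsembleRealization.AugmentedLift

open Literature.Analysis.FunctionSpaces Literature.Analysis.FunctionSpaces.Torus
open Literature.Analysis.FluidPDE Literature.Analysis.FluidPDE.Torus
open Summit.AnomalousDissipation.AnomalousDissipation.Theorems.MomentParity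

variable {ν : ℝ} {f : UnitAddTorus (Fin 3) → EuclideanSpace ℝ (Fin 3)}
  {μ : Measure (Torus.energySpace (Fin 3))}

/-! ### The cylindrically weighted energy inequalities (the predicate `CEI(ν, f, μ)`)

Written INLINE in the two stubs below (so that the registered stub signatures mention tree
declarations only). `CEI(ν, f, μ)` reads: for every finite family `g : Fin m → (T³ → ℝ³)` of smooth
solenoidal mean-zero test fields (cylindrical coordinates `ξ(u) = ((u, g₀), …, (u, g_{m-1})) ∈ ℝ^m`,
`WithLp.toLp 2 fun j => pairing u.1 (g j)`) and every `C¹` profile `ψ : ℝ^m × ℝ → ℝ`, bounded with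
bounded derivative and NONDECREASING in the energy variable,
`2 ∫ ∂ₑψ(ξ(u), |u|²) (ν ‖u‖_V² − (f, u)) dμ ≤ ∫ ⟨F(u), Σⱼ ∂ⱼψ(ξ(u), |u|²) gⱼ⟩ dμ`
with both integrands integrable (`∂ₑψ = fderiv ψ · (0,1)`, `∂ⱼψ = fderiv ψ · (eⱼ, 0)`,
`⟨F(u), w⟩ = nsGeneratorPairing ν f u w`, `‖u‖_V² = eGradNormSq u`). For `ψ = ψ(e)` this is the
Foias–Prodi shell inequality (1.31) (FoiasRosaTemam2019 Def. 4.1 (c), `ψ' ≥ 0` bounded); for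
`ψ = ψ(ξ)` (compactly supported) it is the Liouville identity (1.30). The formal chain rule along a
Leray–Hopf path, `d/dt ψ(ξ(u), |u|²) ≤ Σⱼ ∂ⱼψ ⟨F(u), gⱼ⟩ + 2 ∂ₑψ ((f, u) − ν‖u‖_V²)` (`∂ₑψ ≥ 0`,
`|u(t)|² + ∫₀ᵗ 2(ν‖u‖_V² − (f,u))` nonincreasing), shows every time-average measure satisfies it. -/

/-! ### Stub A (OPEN — the typed residue): Foias–Prodi measures have no mean backscatter -/

/-- **Stub (cylindrically weighted energy inequalities of Foias–Prodi measures).** Every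
Foias–Prodi stationary statistical solution of NS_ν(f), `ν > 0`, `f` smooth solenoidal
mean-zero, satisfies `CEI(ν, f, μ)`. Equivalently (Galerkin approximation of `|u|²` inside
`ψ`, as in `integral_galerkinBalance_eq_zero`): for every nonnegative bounded continuous
`φ(ξ, e)`, `lim_K ∫ φ(ξ(u), |P_K u|²) b(u, u, P_K u) dμ ≥ 0`
(`b(u,u,P_K u) = −inertialPairing u (fourierTruncate K u)`) — no mean energy backscatter from
infinite wavenumber, conditionally on cylindrical data. Known for time-average, Vishik–Fursikov
and Galerkin-limit measures; OPEN for a general Foias–Prodi measure (the definition, FMRT IV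
Def. 1.3 / FoiasRosaTemam2019 Def. 4.1, conditions the energy inequality on `|u|²` only).
[FMRTTurbulence2001 IV (1.30)–(1.31); FoiasRosaTemam2019 Def. 4.1; arXiv:1606.02174 p. 20] -/
theorem stub_cylEnergyIneq (hν : 0 < ν) (hf : IsSmooth f) (hdiv : IsDivFree f) (hf0 : HasZeroMean f)
    (hμ : IsStationaryStatisticalSolution ν f μ) :
    (∀ (m : ℕ) (g : Fin m → UnitAddTorus (Fin 3) → EuclideanSpace ℝ (Fin 3)),
      (∀ j, IsSmooth (g j)) → (∀ j, IsDivFree (g j)) → (∀ j, HasZeroMean (g j)) →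
      ∀ ψ : EuclideanSpace ℝ (Fin m) × ℝ → ℝ, ContDiff ℝ 1 ψ →
        (∃ C : ℝ, ∀ z, |ψ z| ≤ C ∧ ‖fderiv ℝ ψ z‖ ≤ C) →
        (∀ ξ : EuclideanSpace ℝ (Fin m), Monotone fun e : ℝ => ψ (ξ, e)) →
        Integrable (fun u : Torus.energySpace (Fin 3) =>
            fderiv ℝ ψ (WithLp.toLp 2 fun j => pairing u.1 (g j), ‖u‖ ^ 2) (0, 1) *
              (ν * (eGradNormSq (u.1 : UnitAddTorus (Fin 3) → EuclideanSpace ℝ (Fin 3))).toReal - pairing u.1 f)) μ ∧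
        Integrable (fun u : Torus.energySpace (Fin 3) =>
            nsGeneratorPairing ν f u (fun x => ∑ j, fderiv ℝ ψ (WithLp.toLp 2 fun j => pairing u.1 (g j), ‖u‖ ^ 2)
              (EuclideanSpace.single j 1, 0) • g j x)) μ ∧
        2 * ∫ u, fderiv ℝ ψ (WithLp.toLp 2 fun j => pairing u.1 (g j), ‖u‖ ^ 2) (0, 1) *
              (ν * (eGradNormSq (u.1 : UnitAddTorus (Fin 3) → EuclideanSpace ℝ (Fin 3))).toReal - pairing u.1 f) ∂μ ≤
          ∫ u, nsGeneratorPairing ν f u (fun x => ∑ j, fderiv ℝ ψ (WithLp.toLp 2 fun j => pairing u.1 (g j), ‖u‖ ^ 2)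
              (EuclideanSpace.single j 1, 0) • g j x) ∂μ) := by
  sorry

/-! ### Everything else is LANDED (tree `Theorems/StirringSphereEnsembleRealization*.lean`, namespace
`Summit.AnomalousDissipation.AnomalousDissipation.Theorems.EnsembleRealization`):
* stub B (the mechanism, FP + CEI ⇒ admissible shift-invariant Leray–Hopf lift): `stub_augmentedLiftOfCEI`
  (`…AugmentedLiftOfCEI.lean`, p170845) ← `stub_augCurrentLevelPairs` (p170634; Basis p169806, Current p170389, Entry p169212,
  Transport p169213, Marg p169231, Drift p170442/DriftBase p170384, Energy p170443/EnergyGap p170385, Pair p166144,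
  Divergence p166010, Kernel p166006, Profile p166003) + `stub_augCurrentPathLawTools` (p166143; Flow p165979, Field p165996)
  → `stub_augLimit` (p166145; tools p166012 p166016 p166023 p166027 p166053) → `stub_augWeakForm` (p166146; tools p166033)
  → `stub_augEnergy` (p162947) → `stub_restart` (p160746; tools p160271);
* stubs C, D: `stub_marginalMeans` (p159071), `stub_pathwiseCoupling` (p158333);
* tools for stub A: `stub_cylEnergyIneqGalerkinIdentity` (p161944), `stub_cylEnergyIneqFluxLimit` (p162269);
* the composition with CEI as hypothesis: `stub_ensembleRealizationDiss` (the crux on the dissipative class FP + CEI) and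
  `ensembleRealization_of_cei` / `ensemble_ensembleRealization_of_cei` (`…Diss.lean`). -/

/-- **Composition.** `StirringSphere.EnsembleRealization` (= the shared item stmt-AnomalousDissipation-0215) from the
one open stub A (FP ⇒ CEI) and the landed reduction `ensembleRealization_of_cei`. -/
theorem ensembleRealization_of :
    Summit.AnomalousDissipation.AnomalousDissipation.Theses.StirringSphere.EnsembleRealization :=
  Summit.AnomalousDissipation.AnomalousDissipation.Theorems.EnsembleRealization.ensembleRealization_of_cei
    fun _ν _f _μ hν hs hdiv hz hμ => stub_cylEnergyIneq hν hs hdiv hz hμ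

/-- The same composition for route Ensemble's byte-identical decl (the shared item closes both). -/
theorem ensemble_ensembleRealization_of :
    Summit.AnomalousDissipation.AnomalousDissipation.Theses.Ensemble.EnsembleRealization :=
  ensembleRealization_of

end Summit.AnomalousDissipation.AnomalousDissipation.Cruxes.EnsembleRealization.AugmentedLift
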